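import Mathlib.RingTheory.MvPolynomial.WeightedHomogeneous
import Mathlib.Data.Finsupp.Antidiagonal
import Mathlib.Tactic
import HarnessLib

/-!
# ValiantsHypothesis / RyserTripartition — item `PerLeTripartition` (stmt-ValiantsHypothesis-11286):
# group-multilinear components (the algebra of the set-multilinear homogenisation)

For variables `(i, s)` graded by a GROUP `i : G` (weight `Finsupp.single i 1 ∈ G →₀ ℕ`), the
component of multidegree `𝟙_J = Σ_{i ∈ J} single i 1` of a polynomial (`J ⊆ G`: degree exactly `1`
in each group of `J`, `0` in the others) is Mathlib's `weightedHomogeneousComponent`.  This file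
proves the calculus used gate by gate by the homogenisation pass of the bridge `PerLeTripartition`:
the general product rule over the antidiagonal (`weightedHomogeneousComponent_mul_antidiagonal`),
the antidiagonal of `𝟙_J` = the pairs `(𝟙_{J₁}, 𝟙_{J ∖ J₁})` (`sum_antidiagonal_indicator`), hence
`comp_J (f g) = Σ_{J₁ ⊆ J} comp_{J₁} f · comp_{J∖J₁} g` (`groupComp_mul`), and the values on
variables and constants (`groupComp_X`, `groupComp_C`).  HONEST FRAMING: bookkeeping toward a
support item of a dormant route; nothing here bears on `VP ≠ VNP`, which is NOT proved.
-/

-- layout Summits/ValiantsHypothesis/ValiantsHypothesis forces the duplicated namespace component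
set_option linter.dupNamespace false

namespace Summit.ValiantsHypothesis.ValiantsHypothesis.Theorems.RyserTripartition

open Finset MvPolynomial

/-! ### The product rule for weighted homogeneous components -/

/-- **Product rule**: for an additive weight `w : σ → M` into a monoid with antidiagonals, the
weight-`n` component of a product is `Σ_{(n₁,n₂), n₁+n₂ = n} (weight-n₁ component) · (weight-n₂
component)`. [folklore] -/
theorem weightedHomogeneousComponent_mul_antidiagonal {σ R M : Type*} [CommSemiring R]
    [AddCommMonoid M] [DecidableEq M] [Finset.HasAntidiagonal M] (w : σ → M) (n : M)
    (f g : MvPolynomial σ R) :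
    weightedHomogeneousComponent w n (f * g) =
      ∑ p ∈ Finset.antidiagonal n,
        weightedHomogeneousComponent w p.1 f * weightedHomogeneousComponent w p.2 g := by
  classical
  ext d
  rw [coeff_weightedHomogeneousComponent, coeff_sum]
  simp_rw [coeff_mul, coeff_weightedHomogeneousComponent]
  rw [Finset.sum_comm]
  have key : ∀ x ∈ Finset.antidiagonal d,
      (∑ p ∈ Finset.antidiagonal n,
        (if Finsupp.weight w x.1 = p.1 then coeff x.1 f else 0) *
          (if Finsupp.weight w x.2 = p.2 then coeff x.2 g else 0)) =
      if Finsupp.weight w d = n then coeff x.1 f * coeff x.2 g else 0 := by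
    intro x hx
    have hxd : x.1 + x.2 = d := Finset.mem_antidiagonal.mp hx
    have hw : Finsupp.weight w x.1 + Finsupp.weight w x.2 = Finsupp.weight w d := by
      rw [← hxd, map_add]
    by_cases h : Finsupp.weight w d = n
    · rw [if_pos h, Finset.sum_eq_single_of_mem (Finsupp.weight w x.1, Finsupp.weight w x.2)
        (Finset.mem_antidiagonal.mpr (hw.trans h))]
      · simp
      · rintro ⟨p₁, p₂⟩ _ hne
        by_cases h1 : Finsupp.weight w x.1 = p₁
        · have h2 : Finsupp.weight w x.2 ≠ p₂ := fun h2 => hne (by rw [← h1, ← h2])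
          rw [if_neg h2, mul_zero]
        · rw [if_neg h1, zero_mul]
    · rw [if_neg h]
      refine Finset.sum_eq_zero fun p hp => ?_
      have hp' : p.1 + p.2 = n := Finset.mem_antidiagonal.mp hp
      by_cases h1 : Finsupp.weight w x.1 = p.1
      · have h2 : Finsupp.weight w x.2 ≠ p.2 := fun h2 => h (by rw [← hw, h1, h2, hp'])
        rw [if_neg h2, mul_zero]
      · rw [if_neg h1, zero_mul]
  rw [Finset.sum_congr rfl key]
  split_ifs <;> simp

/-! ### Indicator weights `𝟙_J` of sets of groups -/

section Indicator

variable {G : Type*} [DecidableEq G]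

/-- The indicator weight `𝟙_J` evaluated at a group. [folklore] -/
theorem indicator_apply (J : Finset G) (i : G) :
    (∑ j ∈ J, Finsupp.single j 1 : G →₀ ℕ) i = if i ∈ J then 1 else 0 := by
  rw [Finsupp.finsetSum_apply]
  simp_rw [Finsupp.single_apply]
  rw [Finset.sum_ite_eq']

/-- Indicator weights determine their set. [folklore] -/
theorem indicator_injective {J J' : Finset G}
    (h : (∑ j ∈ J, Finsupp.single j 1 : G →₀ ℕ) = ∑ j ∈ J', Finsupp.single j 1) : J = J' := by
  ext i
  have hi := congrArg (fun f : G →₀ ℕ => f i) h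
  simp only [indicator_apply] at hi
  by_cases h1 : i ∈ J <;> by_cases h2 : i ∈ J' <;> simp_all

/-- `𝟙_{J₁} + 𝟙_{J ∖ J₁} = 𝟙_J` for `J₁ ⊆ J`. [folklore] -/
theorem indicator_add_sdiff {J J₁ : Finset G} (h : J₁ ⊆ J) :
    (∑ j ∈ J₁, Finsupp.single j 1 : G →₀ ℕ) + ∑ j ∈ J \ J₁, Finsupp.single j 1 =
      ∑ j ∈ J, Finsupp.single j 1 := by
  rw [← Finset.sum_union Finset.disjoint_sdiff, Finset.union_sdiff_of_subset h]

/-- **The antidiagonal of an indicator weight** consists of the pairs `(𝟙_{J₁}, 𝟙_{J ∖ J₁})`,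
`J₁ ⊆ J`: a sum over it is a sum over the subsets of `J`. [folklore] -/
theorem sum_antidiagonal_indicator {β : Type*} [AddCommMonoid β] (J : Finset G)
    (F : (G →₀ ℕ) → (G →₀ ℕ) → β) :
    ∑ p ∈ Finset.antidiagonal (∑ j ∈ J, Finsupp.single j 1 : G →₀ ℕ), F p.1 p.2 =
      ∑ J₁ ∈ J.powerset, F (∑ j ∈ J₁, Finsupp.single j 1) (∑ j ∈ J \ J₁, Finsupp.single j 1) := by
  classical
  symm
  refine Finset.sum_nbij' (fun J₁ => ((∑ j ∈ J₁, Finsupp.single j 1 : G →₀ ℕ),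
      (∑ j ∈ J \ J₁, Finsupp.single j 1 : G →₀ ℕ)))
    (fun p => J.filter fun i => p.1 i = 1) ?_ ?_ ?_ ?_ ?_
  · intro J₁ hJ₁
    exact Finset.mem_antidiagonal.mpr (indicator_add_sdiff (Finset.mem_powerset.mp hJ₁))
  · intro p _
    exact Finset.mem_powerset.mpr (Finset.filter_subset _ _)
  · intro J₁ hJ₁
    have hsub := Finset.mem_powerset.mp hJ₁
    ext i
    simp only [Finset.mem_filter, indicator_apply]
    constructor
    · rintro ⟨_, h⟩; by_contra hc; rw [if_neg hc] at h; exact absurd h (by norm_num)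
    · intro h; exact ⟨hsub h, by rw [if_pos h]⟩
  · rintro ⟨a, b⟩ hab
    have hab' : a + b = ∑ j ∈ J, Finsupp.single j 1 := Finset.mem_antidiagonal.mp hab
    have hpt : ∀ i, a i + b i = if i ∈ J then 1 else 0 := fun i => by
      rw [← indicator_apply J i, ← hab']; rfl
    have ha : a = ∑ j ∈ J.filter (fun i => a i = 1), Finsupp.single j 1 := by
      ext i
      rw [indicator_apply]
      have := hpt i
      split_ifs at this with hi
      · simp only [Finset.mem_filter, hi, true_and]
        split_ifs with h1
        · exact h1
        · omega
      · simp only [Finset.mem_filter, hi, false_and, if_false]; omega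
    have hb : b = ∑ j ∈ J \ J.filter (fun i => a i = 1), Finsupp.single j 1 := by
      ext i
      rw [indicator_apply]
      have := hpt i
      simp only [Finset.mem_sdiff, Finset.mem_filter]
      split_ifs at this with hi
      · by_cases h1 : a i = 1
        · simp [hi, h1]; omega
        · simp [hi, h1]; omega
      · simp [hi]; omega
    exact Prod.ext ha.symm hb.symm
  · intro J₁ _; rfl

end Indicator

/-! ### Group-multilinear components -/

section GroupComp

variable {G : Type*} [DecidableEq G] {S : Type*} {R : Type*} [CommSemiring R]

/-- **Component of a product**: `comp_J (f g) = Σ_{J₁ ⊆ J} comp_{J₁}(f) · comp_{J∖J₁}(g)` for the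
group grading `(i, s) ↦ single i 1`. [folklore] -/
theorem groupComp_mul (J : Finset G) (f g : MvPolynomial (G × S) R) :
    weightedHomogeneousComponent (fun v : G × S => (Finsupp.single v.1 1 : G →₀ ℕ))
        (∑ j ∈ J, Finsupp.single j 1) (f * g) =
      ∑ J₁ ∈ J.powerset,
        weightedHomogeneousComponent (fun v : G × S => (Finsupp.single v.1 1 : G →₀ ℕ))
            (∑ j ∈ J₁, Finsupp.single j 1) f *
          weightedHomogeneousComponent (fun v : G × S => (Finsupp.single v.1 1 : G →₀ ℕ))
            (∑ j ∈ J \ J₁, Finsupp.single j 1) g := by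
  classical
  rw [weightedHomogeneousComponent_mul_antidiagonal]
  exact sum_antidiagonal_indicator J (fun a b =>
    weightedHomogeneousComponent (fun v : G × S => (Finsupp.single v.1 1 : G →₀ ℕ)) a f *
      weightedHomogeneousComponent (fun v : G × S => (Finsupp.single v.1 1 : G →₀ ℕ)) b g)

/-- **Component of a variable**: `comp_J (X (i,s)) = X (i,s)` if `J = {i}`, else `0`. [folklore] -/
theorem groupComp_X (J : Finset G) (v : G × S) :
    weightedHomogeneousComponent (fun v : G × S => (Finsupp.single v.1 1 : G →₀ ℕ))
        (∑ j ∈ J, Finsupp.single j 1) (X v : MvPolynomial (G × S) R) =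
      if J = {v.1} then X v else 0 := by
  classical
  rw [weightedHomogeneousComponent_of_mem (isWeightedHomogeneous_X R _ v)]
  have hsingle : (Finsupp.single v.1 1 : G →₀ ℕ) = ∑ j ∈ ({v.1} : Finset G), Finsupp.single j 1 := by
    rw [Finset.sum_singleton]
  by_cases h : J = {v.1}
  · rw [if_pos h, if_pos (by rw [h, hsingle])]
  · rw [if_neg h, if_neg]
    intro h'
    rw [hsingle] at h'
    exact h (indicator_injective h')

/-- **Component of a constant**: `comp_J (C c) = C c` if `J = ∅`, else `0`. [folklore] -/
theorem groupComp_C (J : Finset G) (c : R) :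
    weightedHomogeneousComponent (fun v : G × S => (Finsupp.single v.1 1 : G →₀ ℕ))
        (∑ j ∈ J, Finsupp.single j 1) (C c : MvPolynomial (G × S) R) =
      if J = ∅ then C c else 0 := by
  classical
  rw [weightedHomogeneousComponent_of_mem (isWeightedHomogeneous_C _ c)]
  have hempty : (0 : G →₀ ℕ) = ∑ j ∈ (∅ : Finset G), Finsupp.single j 1 := by
    rw [Finset.sum_empty]
  by_cases h : J = ∅
  · rw [if_pos h, if_pos (by rw [h, Finset.sum_empty])]
  · rw [if_neg h, if_neg]
    intro h'
    rw [hempty] at h'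
    exact h (indicator_injective h')

omit [DecidableEq G] in
/-- The component of `0` is `0`. [folklore] -/
theorem groupComp_zero (J : Finset G) :
    weightedHomogeneousComponent (fun v : G × S => (Finsupp.single v.1 1 : G →₀ ℕ))
        (∑ j ∈ J, Finsupp.single j 1) (0 : MvPolynomial (G × S) R) = 0 :=
  map_zero _

end GroupComp

end Summit.ValiantsHypothesis.ValiantsHypothesis.Theorems.RyserTripartition
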